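import Literature.NumberTheory.Automorphic.ReciprocityGLnExistenceProofs
import Mathlib.NumberTheory.NumberField.CMField
import HarnessLib

/-!
# `GaloisRepGL2CMae`, line `Sketch`, step `Thm713Step` (route `IrreducibilityBySelfDuality`, supports item stmt-Langlands-16722)

Crux `Summit.Langlands.Langlands.Theses.IrreducibilityBySelfDuality.GaloisRepGL2CMae`
(stmt-Langlands-16722) is Harris–Lan–Taylor–Thorne 2016, Thm. A for `GL₂` over CM fields, read almost
everywhere.  The line `Sketch` cuts HLTT's own proof at the twisted additive pair; this file proves its
fourth step (registered stub `stub_thm713` of the line skeleton), a pure glue step: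

  **Cor. 6.27 at `n = 2` (unramified alternative) over PRESENTED CM fields
    ⟹ Thm. 7.13 at `n = 2` (unramified alternative) for every CM field `K` (Mathlib `NumberField.IsCMField`).**

Here "presented CM field" means the data HLTT §6 works with: a totally real `F⁺ = Fp`, a quadratic
extension `K/Fp` which is totally complex, and its non-trivial `Fp`-involution `cK`; both sides carry the
standing datum of HLTT p. 11, an imaginary quadratic `E₀ ⊆ K` in which `p` splits
(`NumberField.HasTwoPrimesOver E₀ p`).

## Proof

Given `K` with `NumberField.IsCMField K`, present it as `K / K⁺` with `K⁺ = NumberField.maximalRealSubfield K`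
(totally real: `NumberField.isTotallyReal_maximalRealSubfield`; quadratic:
`NumberField.IsCMField.isQuadraticExtension`; `K` totally complex: `NumberField.IsCMField.isTotallyComplex`)
and `cK = NumberField.IsCMField.complexConj K ≠ 1` (`NumberField.IsCMField.complexConj_ne_one`).  The
hypothesis then yields the Cor. 6.27 data `N₀, R_N : Γ_K → GL₄(ℚ̄_p), B_v` at the good places (`v ∣ q`,
`q ≠ p` prime unramified in `K`, `π` unramified above `q`), and HLTT's Prop. 7.12 engine — the proved
Literature theorem `HarrisLanTaylorThorne2016.exists_isGaloisCompatibleAt_of_goodPrime` (the printed proof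
of Thm. 7.13, p. 232), fed with the proved leaves `prop712Hausdorff_holds`, `chebotarev_artinRep_holds`,
`hasSatakeParamAt_ne_zero_holds` and Flath's `hasSatakeParamAt_cofinite_holds` (finiteness of the bad
places, `finite_setOf_not_exists_goodPrime`) — extracts the continuous semisimple `r : Γ_K → GL₂(ℚ̄_p)`
with `IsGaloisCompatibleAt π ı r v` at every good place.

The statement is written out in tree vocabulary (Literature + Mathlib constants only), verbatim the
registered stub signature, so that the line skeleton can cite it by name; this file imports no `Summits`
module.

References: M. Harris, K.-W. Lan, R. Taylor, J. Thorne, *On the rigid cohomology of certain Shimura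
varieties*, Res. Math. Sci. 3:37 (2016), Cor. 6.27 (p. 225), Prop. 7.12, Thm. 7.13 and its proof
(p. 232) [HarrisLanTaylorThorneRMS2016].
-/

set_option linter.dupNamespace false -- project-wide option (lakefile weak.linter.dupNamespace); `Summit.Langlands.Langlands` is the mandated namespace

noncomputable section

open scoped MatrixGroups Matrix NumberField Polynomial
open NumberField IsDedekindDomain Field Polynomial Filter
open Literature.NumberTheory.Automorphic Literature.NumberTheory.GaloisRepresentations
open Literature.NumberTheory.Automorphic.HarrisLanTaylorThorne2016

namespace Summit.Langlands.Langlands.Theorems.GaloisRepGL2CMae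

/-- **Step `Thm713Step` of line `Sketch` for the crux `GaloisRepGL2CMae`** (stmt-Langlands-16722):
Harris–Lan–Taylor–Thorne 2016, Cor. 6.27 at `n = 2` in its unramified alternative, stated over
presented CM fields (`Fp` totally real, `K/Fp` quadratic and totally complex, `cK ≠ 1` an
`Fp`-involution of `K`; `E₀ ⊆ K` imaginary quadratic with two primes over `p`; output: `N₀`, a family
`R_N : Γ_K → GL₄(ℚ̄_p)` semisimple for `N ≥ N₀`, `2`-element multisets `B_v ∌ 0`, and at every good
place `v ∣ q` — `q ≠ p` prime unramified in `K`, `π` unramified above `q` — `R_N` unramified with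
Frobenius characteristic polynomial `arithFrobPolyOfSatake ı q_v 2 α_v · ∏_{b ∈ B_v}(X - b q_v^{-2N})`)
**implies** Thm. 7.13 at `n = 2` in its unramified alternative for every CM field `K`
(Mathlib `NumberField.IsCMField K`) with the same `E₀`-datum: for `π` cuspidal regular algebraic on
`GL₂(𝔸_K)` and `ı : ℚ̄_p ≃ ℂ` there is a continuous semisimple `r : Γ_K → GL₂(ℚ̄_p)` with
`IsGaloisCompatibleAt π ı r v` at every `v ∣ q`, `q ≠ p` prime unramified in `K`, `π` unramified above
`q`.  Proof: present `K` as `K / K⁺` (`NumberField.maximalRealSubfield K`,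
`NumberField.IsCMField.complexConj K`, `NumberField.IsCMField.complexConj_ne_one`,
`Algebra.IsQuadraticExtension.finrank_eq_two`), take the Cor. 6.27 data from the hypothesis, and run the proved
Prop. 7.12 engine `HarrisLanTaylorThorne2016.exists_isGaloisCompatibleAt_of_goodPrime` (the printed
proof of Thm. 7.13) with the proved leaves `prop712Hausdorff_holds`, `chebotarev_artinRep_holds`,
`hasSatakeParamAt_ne_zero_holds`, `hasSatakeParamAt_cofinite_holds`
(`finite_setOf_not_exists_goodPrime`).
[cite: HarrisLanTaylorThorneRMS2016, Thm. 7.13 and its proof (p. 232)] -/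
theorem stub_thm713 :
    (∀ (Fp K : Type) [Field Fp] [NumberField Fp] [Field K] [NumberField K] [Algebra Fp K]
      (cK : K ≃ₐ[Fp] K), IsTotallyReal Fp → Module.finrank Fp K = 2 → cK ≠ 1 →
      IsTotallyComplex K →
      ∀ (hcpt : isCompact_glFiniteIntegralLevel 2 K) (p : ℕ) [Fact p.Prime]
        (E₀ : IntermediateField ℚ K), Module.finrank ℚ E₀ = 2 ∧ IsTotallyComplex E₀ →
        HasTwoPrimesOver E₀ p →
      ∀ (π : CuspidalAutomorphicRepData 2 K hcpt), π.1.IsRegularAlgebraic →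
      ∀ (ι : PadicAlgCl p ≃+* ℂ),
      ∃ (N₀ : ℕ) (R : ℕ → FramedGaloisRep K (PadicAlgCl p) 4)
        (B : HeightOneSpectrum (𝓞 K) → Multiset (PadicAlgCl p)),
        (∀ N, N₀ ≤ N → (R N).toGaloisRep.IsSemisimple) ∧
        (∀ v, Multiset.card (B v) = 2 ∧ (0 : PadicAlgCl p) ∉ B v) ∧
        ∀ v, (∃ q : ℕ, q.Prime ∧ q ≠ p ∧ ((q : ℕ) : 𝓞 K) ∈ v.asIdeal ∧
            Algebra.IsUnramifiedIn (𝓞 K) (Ideal.span {(q : ℤ)}) ∧ π.1.IsUnramifiedAbove q) →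
          ∀ α : Multiset ℂ, π.1.HasSatakeParamAt v α →
          ∀ N, N₀ ≤ N → (R N).IsUnramifiedAt v ∧
            (R N).HasFrobCharpolyAt v (arithFrobPolyOfSatake ι v.residueCard 2 α *
              ((B v).map fun b ↦
                X - C (b * ((v.residueCard : PadicAlgCl p)⁻¹) ^ (2 * N))).prod)) →
    ∀ (K : Type) [Field K] [NumberField K], IsCMField K →
      ∀ (hcpt : isCompact_glFiniteIntegralLevel 2 K) (p : ℕ) [Fact p.Prime]
        (E₀ : IntermediateField ℚ K), Module.finrank ℚ E₀ = 2 ∧ IsTotallyComplex E₀ →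
        HasTwoPrimesOver E₀ p →
      ∀ (π : CuspidalAutomorphicRepData 2 K hcpt), π.1.IsRegularAlgebraic →
      ∀ (ι : PadicAlgCl p ≃+* ℂ),
      ∃ r : FramedGaloisRep K (PadicAlgCl p) 2, r.toGaloisRep.IsSemisimple ∧
        ∀ q : ℕ, q.Prime → q ≠ p → Algebra.IsUnramifiedIn (𝓞 K) (Ideal.span {(q : ℤ)}) →
          π.1.IsUnramifiedAbove q →
          ∀ v : HeightOneSpectrum (𝓞 K), ((q : ℕ) : 𝓞 K) ∈ v.asIdeal →
            IsGaloisCompatibleAt π.1 ι r v := by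
  intro h627 K _ _ hCM hcpt p _ E₀ hE₀ hsplit π hπ ι
  haveI := hCM
  -- the presentation `K = K⁺(complexConj)` and the Cor. 6.27 data over it
  obtain ⟨N₀, R, B, hRss, hB, hR⟩ := h627 (↥(maximalRealSubfield K)) K (IsCMField.complexConj K)
    inferInstance (Algebra.IsQuadraticExtension.finrank_eq_two _ K) (IsCMField.complexConj_ne_one K)
    inferInstance hcpt p E₀ hE₀ hsplit π hπ ι
  -- the Prop. 7.12 engine (printed proof of Thm. 7.13), good primes = unramified in `K`
  exact exists_isGaloisCompatibleAt_of_goodPrime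
    Literature.NumberTheory.GaloisRepresentations.HarrisLanTaylorThorne2016.prop712Hausdorff_holds
    chebotarev_artinRep_holds hasSatakeParamAt_ne_zero_holds p two_pos π.1 ι
    (fun q ↦ Algebra.IsUnramifiedIn (𝓞 K) (Ideal.span {(q : ℤ)}))
    (finite_setOf_not_exists_goodPrime π.1 π.1.hasSatakeParamAt_cofinite_holds p Fact.out)
    hRss hB (fun q hq hqp hQ hπq v hqv α hα N hN ↦ hR v ⟨q, hq, hqp, hqv, hQ, hπq⟩ α hα N hN)

end Summit.Langlands.Langlands.Theorems.GaloisRepGL2CMae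

end
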